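import Summits.ABC.IUTFork.LDHPrimewise
import Literature.IUT.LogVolume.TensorPacketModelScaled
import Literature.IUT.LogVolume.TensorPacketOrbits
import HarnessLib

/-!
# The fork at [IUTchIII] Corollary 3.12, L-DH level (c312-3), II-d: Dupuy–Hilado data over the REAL
# tensor-packet models (`DHData` over `tensorPacketModel 𝔽` / `tensorPacketModelM 𝔽`, `hull(U_Θ)` admissible
# PROVED; in Mochizuki's shell normalisation the MINIMAL datum exists for any ideles)

Record-only file (D-0012) of the abc-iut cell (Cor. 3.12 sub-crew, seat abc-iut-c312-3); TAKES NO SIDE.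
Dupuy–Hilado, arXiv:2004.13228 (pre-split text) §3.9 "let `a = (a_{v̲}) ∈ 𝔸_{V̲}` be such that `D = div(a)`",
§4.10 (the (Ind3)-bound (4.10)), §4.11–4.12 (`U_Θ`, the hull), read on the page (render chunks 12, 15–16);
[IUTchIII] Cor. 3.12 (kurims p. 173) "it holds that `−|log(Θ)| ∈ ℝ`"; [IUTchI] Ex. 3.2 (iv) (kurims p. 71)
"`q̲_v := q_v^{1/2l} ∈ O^▷`" — the `2l`-th roots that make `ord_v(t_{q,v}) = P_q(v) = ord_v(q_v)/(2l)` realisable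
in `K_{v̲}` (audit note R7-C3-N2, abc-iut-L6-t24: the model's `ord_v` is fractional on `K_{v̲} ⊋ F_v`, so the
ideles are INPUTS realised in the fields of initial theta data, not in `F_v`); [IUTchIV] Prop. 1.2 (ii) "In
particular" (kurims p. 10) "`φ((R_I)^∼) ⊆ p^{−⌈d_I+a_I⌉}·log_p(R_I^×)`".

WHAT THIS FILE DOES.
* `PrimePacket.realDHDatumWith` builds the datum of `DHData` AT A PRIME over the real packet with any shell
  normalisation `c` (`realPrimePacketWith p 𝔽 c`, `TensorPacketModelScaled.lean`; `c = (2p)^{−|I|}` is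
  Dupuy–Hilado's `realPrimePacket`, `c = p^{−⌈d_I+a_I⌉}` is Mochizuki's `realPrimePacketM`) from: the
  `p`-components of the ideles (units of the `K_{v̲}` with the printed valuations — INPUT) and a region
  `(O_𝕃(−P_Θ))^{Ind3}_p` that is admissible, contains the bare region, satisfies the (4.10)-shaped bound and is
  BOUNDED in every summand (INPUT); it PROVES the admissibility of `hull(U_Θ)_p` ("`−|log(Θ)| ∈ ℝ`" at `p`):
  the (Ind1)-images of bounded regions are bounded, ONE translate `c·(R_I)^∼` contains all their (Ind2)-images
  (`TensorPacketOrbits.exists_forall_indTwo_image_subset`), the `(R_I)^∼`-span of the union stays in that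
  translate, and the union contains the nondegenerate translate `O_𝕃(−P_Θ)_{v⃗}` (abc-iut-S2's
  `packetAdm_packetHull`).
* `PrimePacket.minimalDHDatumM`: in MOCHIZUKI's normalisation the MINIMAL choice `(O_𝕃(−P_Θ))^{Ind3} := O_𝕃(−P_Θ)`
  satisfies the (4.10)-shaped bound for EVERY idele (Prop. 1.2 (ii) with `φ = id`, abc-iut-S6's `prop12ii'_holds`),
  so a datum exists from the ideles ALONE. In Dupuy–Hilado's normalisation this FAILS at wildly ramified tuples:
  the cell's question R7-C3-Q1 was answered NO by exact computation (seat abc-iut-c312-d1,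
  `HOME/plan/c312/R7C3Q1-COMPUTATION.md`: for `K_{v̲_0} = K_{v̲_1} = ℚ_3(∛3)`, `(R_I)^∼ ⊄ I_{v⃗}` and
  `t·(R_I)^∼ ⊄ ⋃_n t^n·I_{v⃗}` for every unit `t`, so NO (Ind3)-datum with shell `I_{v⃗}` exists at such a tuple
  with a unit last slot) — hence `realDHDatum`/`DHData.ofTensor` (DH normalisation) take the region as an
  INPUT that may not exist for wild `𝔽`, while `minimalDHDatumM`/`DHData.ofIdelesM` (Mochizuki's container,
  [IUTchIV] Prop. 1.2 (ii) / Thm. 1.10 Step (v) "a suitable nonpositive integer power of `p_{v_ℚ}`") always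
  exist. The cell records BOTH normalisations as named instances (planner ruling R6-a); nothing here says which
  one [IUTchIII] Thm. 3.11 (ii) (Ind3) means.
* `DHData.ofTensor` / `ofTensorWith` / `ofTensorM` assemble the data over `tensorPacketModel 𝔽` /
  `tensorPacketModelM 𝔽` (`LDHPrimewise.DHData.ofPrimesLine`); then EVERY theorem of `LDHCor312` /
  `LDHCor312Primes` (Thm. 3.10.1 at the pilots, `cor312DH_iff_inflation`, `free_inequality`, the squeeze, the
  prime-set monotonicity) holds for real tensor packets with NO interface axiom and NO modelling field left —
  e.g. `free_inequality_ofTensor`; and `DHData.ofIdelesM` is a datum built from ideles only.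

[cite: DupuyHilado2025, §3.9, §4.10–4.12] [cite: Mochizuki2012, IUTchIV Prop. 1.2 (ii) p. 10]
[claim: Mochizuki2012, status: disputed] Nothing asserted: `Cor312DH` of such a datum is Dupuy–Hilado's (1.1) for
real packets, a HYPOTHESIS. Deliberately NOT here: the value of `ln ν̄_𝕃(hull(U_Θ))` ([IUTchIV] Thm. 1.10 Step
(v): seats abc-iut-S2/S8/c312-d1); which shell normalisation (Ind3) of [IUTchIII] Thm. 3.11 (ii) means.
-/

noncomputable section

open Set

namespace Literature.IUT.LogVolume

open NumberField IsDedekindDomain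
open scoped Pointwise

variable {F : Type} [Field F] [NumberField F]

namespace PrimePacket

variable {p : ℕ} [Fact p.Prime] (𝔽 : LocalFields F p) (X : PilotData F)
variable (c : (j : ℕ) → (Fin (j + 1) → placesOver F p) → ℚ_[p]) (hc0 : ∀ j e, c j e ≠ 0)
  (hcσ : ∀ (j : ℕ) (σ : Equiv.Perm (Fin (j + 1))) (e : Fin (j + 1) → placesOver F p), c j (e ∘ σ) = c j e)

/-- In the real packet (any shell normalisation), `O_𝕃(−div t)_{v⃗}` is a NONDEGENERATE translate of `(R_I)^∼`:
`ι_j(t_{j,v_j})·(R_I)^∼` in the degrees `1 ≤ j ≤ ℓ⋇`, `(R_I)^∼` itself otherwise. [cite: DupuyHilado2025, §3.9] -/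
theorem exists_regionOf_eq_smul {lstar : ℕ} (t : Fin lstar → (v : placesOver F p) → (𝔽.k v)ˣ) (j : ℕ)
    (e : Fin (j + 1) → placesOver F p) :
    ∃ g : PacketAlgebra p (fun i => 𝔽.k (e i)), (∀ j', dEquiv p (fun i => 𝔽.k (e i)) g j' ≠ 0) ∧
      (realPrimePacketWith p 𝔽 c hc0 hcσ).regionOf t j e =
        g • (normalizedPacket p (fun i => 𝔽.k (e i)) : Set (PacketAlgebra p (fun i => 𝔽.k (e i)))) := by
  unfold PrimePacket.regionOf
  by_cases h : 0 < j ∧ j - 1 < lstar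
  · rw [dif_pos h]
    exact ⟨_, dEquiv_iota_ne_zero p (fun i => 𝔽.k (e i)) (Fin.last j) (t ⟨j - 1, h.2⟩ (e (Fin.last j))).ne_zero,
      realPrimePacket_peel_image p 𝔽 _ _⟩
  · rw [dif_neg h]
    refine ⟨1, fun j' => ?_, ?_⟩
    · rw [map_one, Pi.one_apply]
      exact one_ne_zero
    · rw [one_smul]
      rfl

/-- **The real Dupuy–Hilado datum at the prime `p`** (any shell normalisation `c`): ideles with the printed
valuations and a bounded (Ind3)-region as INPUTS; the admissibility of `hull(U_Θ)_p` ("`−|log(Θ)| ∈ ℝ`" at `p`)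
PROVED. [cite: DupuyHilado2025, §3.9, §4.10–4.12] -/
def realDHDatumWith
    (tΘ : Fin X.lstar → (v : placesOver F p) → (𝔽.k v)ˣ)
    (tΘ_ord : ∀ (i : Fin X.lstar) (v : placesOver F p), 𝔽.ordv (tΘ i v) = X.thetaPilot i v.1)
    (tq : Fin X.lstar → (v : placesOver F p) → (𝔽.k v)ˣ)
    (tq_ord : ∀ (i : Fin X.lstar) (v : placesOver F p), 𝔽.ordv (tq i v) = X.qPilot v.1)
    (bare3 : (j : ℕ) → (e : Fin (j + 1) → placesOver F p) → Set (PacketAlgebra p (fun i => 𝔽.k (e i))))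
    (bare3_adm : ∀ j e, PacketAdm p (fun i => 𝔽.k (e i)) (bare3 j e))
    (region_subset : ∀ j e, (realPrimePacketWith p 𝔽 c hc0 hcσ).regionOf tΘ j e ⊆ bare3 j e)
    (subset_bound : ∀ (i : Fin X.lstar) (e : Fin ((i : ℕ) + 1 + 1) → placesOver F p),
      bare3 ((i : ℕ) + 1) e ⊆
        ⋃ n : ℕ, ((realPrimePacketWith p 𝔽 c hc0 hcσ).peel (tΘ i (e (Fin.last _))))^[n] ''
          (realPrimePacketWith p 𝔽 c hc0 hcσ).shell ((i : ℕ) + 1) e)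
    (bare3_bdd : ∀ j e, IsPsiBounded p (fun i => 𝔽.k (e i)) (bare3 j e)) :
    (realPrimePacketWith p 𝔽 c hc0 hcσ).DHDatum X where
  tΘ := tΘ
  tΘ_ord := tΘ_ord
  tq := tq
  tq_ord := tq_ord
  bare3 := bare3
  bare3_adm := bare3_adm
  region_subset := region_subset
  subset_bound := subset_bound
  hull_adm j e := by
    -- the (Ind1)-images of the bounded (Ind3)-regions form ONE bounded set `A`
    have hA : IsPsiBounded p (fun i => 𝔽.k (e i))
        (⋃ σ : Equiv.Perm (Fin (j + 1)), permAlgEquiv p (fun i => 𝔽.k (e i)) σ '' bare3 j (e ∘ σ)) :=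
      isPsiBounded_iUnion p (fun i => 𝔽.k (e i)) fun σ =>
        isPsiBounded_image_perm p (fun i => 𝔽.k (e i)) σ (bare3_bdd j (e ∘ σ))
    -- ONE translate containing every (Ind2)-image of `A`
    obtain ⟨g, hg, hgA⟩ := exists_forall_indTwo_image_subset p (fun i => 𝔽.k (e i)) hA
    -- the bare region, a nondegenerate translate, lies in the local union (identity indeterminacies)
    obtain ⟨t, ht, hreg⟩ := exists_regionOf_eq_smul 𝔽 c hc0 hcσ tΘ j e
    have hlow : t • (normalizedPacket p (fun i => 𝔽.k (e i)) : Set (PacketAlgebra p (fun i => 𝔽.k (e i)))) ⊆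
        (realPrimePacketWith p 𝔽 c hc0 hcσ).localUTheta bare3 j e := by
      rw [← hreg]
      refine (region_subset j e).trans fun x hx => ?_
      refine Set.mem_iUnion.mpr ⟨1, Set.mem_iUnion.mpr ⟨1, ?_⟩⟩
      rw [one_smul]
      exact ⟨x, hx, permAlgEquiv_one_apply p (fun i => 𝔽.k (e i)) x⟩
    -- the local union lies in the translate `g·(R_I)^∼`
    have hup : (realPrimePacketWith p 𝔽 c hc0 hcσ).localUTheta bare3 j e ⊆
        g • (normalizedPacket p (fun i => 𝔽.k (e i)) : Set (PacketAlgebra p (fun i => 𝔽.k (e i)))) := by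
      intro x hx
      obtain ⟨g', hx⟩ := Set.mem_iUnion.mp hx
      obtain ⟨σ, hx⟩ := Set.mem_iUnion.mp hx
      have hx' := (Set.ext_iff.mp (indTwo_smul_set p (fun i => 𝔽.k (e i)) g'
        (permAlgEquiv p (fun i => 𝔽.k (e i)) σ '' bare3 j (e ∘ σ))) x).mp hx
      refine hgA _ g'.2 (image_mono ?_ hx')
      exact Set.subset_iUnion (fun σ' => permAlgEquiv p (fun i => 𝔽.k (e i)) σ' '' bare3 j (e ∘ σ')) σ
    exact packetAdm_packetHull p (fun i => 𝔽.k (e i)) hg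
      (packetAdm_smul_normalizedPacket p (fun i => 𝔽.k (e i)) t ht) hlow hup

/-- **The real datum in Dupuy–Hilado's normalisation** (`realPrimePacket`, shell `(2p)^{−|I|}·log_p(R_I^×)`).
[cite: DupuyHilado2025, §3.9, §4.10–4.12] -/
def realDHDatum
    (tΘ : Fin X.lstar → (v : placesOver F p) → (𝔽.k v)ˣ)
    (tΘ_ord : ∀ (i : Fin X.lstar) (v : placesOver F p), 𝔽.ordv (tΘ i v) = X.thetaPilot i v.1)
    (tq : Fin X.lstar → (v : placesOver F p) → (𝔽.k v)ˣ)
    (tq_ord : ∀ (i : Fin X.lstar) (v : placesOver F p), 𝔽.ordv (tq i v) = X.qPilot v.1)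
    (bare3 : (j : ℕ) → (e : Fin (j + 1) → placesOver F p) → Set (PacketAlgebra p (fun i => 𝔽.k (e i))))
    (bare3_adm : ∀ j e, PacketAdm p (fun i => 𝔽.k (e i)) (bare3 j e))
    (region_subset : ∀ j e, (realPrimePacket p 𝔽).regionOf tΘ j e ⊆ bare3 j e)
    (subset_bound : ∀ (i : Fin X.lstar) (e : Fin ((i : ℕ) + 1 + 1) → placesOver F p),
      bare3 ((i : ℕ) + 1) e ⊆
        ⋃ n : ℕ, ((realPrimePacket p 𝔽).peel (tΘ i (e (Fin.last _))))^[n] '' logShell p (fun i' => 𝔽.k (e i')))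
    (bare3_bdd : ∀ j e, IsPsiBounded p (fun i => 𝔽.k (e i)) (bare3 j e)) :
    (realPrimePacket p 𝔽).DHDatum X :=
  realDHDatumWith 𝔽 X (fun j _ => shellScalar p (I := Fin (j + 1))) (fun _ _ => shellScalar_ne_zero p)
    (fun _ _ _ => rfl) tΘ tΘ_ord tq tq_ord bare3 bare3_adm region_subset subset_bound bare3_bdd

/-- **In Mochizuki's normalisation, the MINIMAL datum from the ideles alone**: `(O_𝕃(−P_Θ))^{Ind3}_p :=
O_𝕃(−P_Θ)_p` is admissible, bounded, and satisfies the (4.10)-shaped bound (Prop. 1.2 (ii) with `φ = id`: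
`(R_I)^∼ ⊆ p^{−⌈d_I+a_I⌉}·log_p(R_I^×)`, take `n = 1`); `hull(U_Θ)_p` admissible by `realDHDatumWith`.
[cite: Mochizuki2012, IUTchIV Prop. 1.2 (ii) p. 10] -/
def minimalDHDatumM
    (tΘ : Fin X.lstar → (v : placesOver F p) → (𝔽.k v)ˣ)
    (tΘ_ord : ∀ (i : Fin X.lstar) (v : placesOver F p), 𝔽.ordv (tΘ i v) = X.thetaPilot i v.1)
    (tq : Fin X.lstar → (v : placesOver F p) → (𝔽.k v)ˣ)
    (tq_ord : ∀ (i : Fin X.lstar) (v : placesOver F p), 𝔽.ordv (tq i v) = X.qPilot v.1) :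
    (realPrimePacketM p 𝔽).DHDatum X :=
  realDHDatumWith 𝔽 X (mScale p 𝔽) (mScale_ne_zero p 𝔽) (mScale_perm p 𝔽) tΘ tΘ_ord tq tq_ord
    (fun j e => (realPrimePacketM p 𝔽).regionOf tΘ j e)
    (fun j e => by
      obtain ⟨g, hg, hreg⟩ := exists_regionOf_eq_smul 𝔽 (mScale p 𝔽) (mScale_ne_zero p 𝔽) (mScale_perm p 𝔽) tΘ j e
      rw [show (realPrimePacketM p 𝔽).regionOf tΘ j e = _ from hreg]
      exact packetAdm_smul_normalizedPacket p (fun i => 𝔽.k (e i)) g hg)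
    (fun _ _ => le_rfl)
    (fun i e => by
      have h : 0 < (i : ℕ) + 1 ∧ (i : ℕ) + 1 - 1 < X.lstar := ⟨Nat.succ_pos _, by have := i.2; omega⟩
      have hfin : (⟨(i : ℕ) + 1 - 1, h.2⟩ : Fin X.lstar) = i := Fin.ext (by simp)
      have hreg : (realPrimePacketM p 𝔽).regionOf tΘ ((i : ℕ) + 1) e =
          (realPrimePacketM p 𝔽).peel (tΘ i (e (Fin.last _))) '' (realPrimePacketM p 𝔽).O ((i : ℕ) + 1) e := by
        unfold PrimePacket.regionOf
        rw [dif_pos h, hfin]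
      rw [hreg]
      exact peel_normalizedPacket_subset_iUnion_M p 𝔽 i e (tΘ i (e (Fin.last _))))
    (fun j e => by
      obtain ⟨g, _, hreg⟩ := exists_regionOf_eq_smul 𝔽 (mScale p 𝔽) (mScale_ne_zero p 𝔽) (mScale_perm p 𝔽) tΘ j e
      rw [show (realPrimePacketM p 𝔽).regionOf tΘ j e = _ from hreg]
      exact isPsiBounded_smul_normalizedPacket p (fun i => 𝔽.k (e i)) g)

/-- The minimal datum IS sharp: its (Ind3)-region is the bare region `O_𝕃(−P_Θ)_p` itself (the SHARP reading of
the cell's planner ruling R6-a; no log-shell absorbed). [cite: DupuyHilado2025, §4.10] -/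
theorem minimalDHDatumM_bare3
    (tΘ : Fin X.lstar → (v : placesOver F p) → (𝔽.k v)ˣ)
    (tΘ_ord : ∀ (i : Fin X.lstar) (v : placesOver F p), 𝔽.ordv (tΘ i v) = X.thetaPilot i v.1)
    (tq : Fin X.lstar → (v : placesOver F p) → (𝔽.k v)ˣ)
    (tq_ord : ∀ (i : Fin X.lstar) (v : placesOver F p), 𝔽.ordv (tq i v) = X.qPilot v.1) :
    (minimalDHDatumM 𝔽 X tΘ tΘ_ord tq tq_ord).bare3 = (realPrimePacketM p 𝔽).regionOf tΘ := rfl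

end PrimePacket

end Literature.IUT.LogVolume

/-! ## `DHData` over the tensor-packet models -/

namespace Summit.ABC.IUTFork

open Literature.IUT.LogVolume NumberField IsDedekindDomain
open scoped Pointwise

variable {F : Type} [Field F] [NumberField F]

namespace DHData

/-- **Dupuy–Hilado data over the REAL tensor-packet model** (DH normalisation): pilot data `X`, a local field
family `𝔽`, REAL data at every prime (`PrimePacket.realDHDatum`: ideles + bounded (Ind3)-regions), a finite set of
primes `T ⊇ {p_v : v ∈ S}`; the model is `tensorPacketModel 𝔽` (`ofTensor_M`). Every theorem of `LDHCor312*`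
applies. [cite: DupuyHilado2025, §3.9, §4.10–4.12] -/
def ofTensor (X : PilotData F) (𝔽 : LocalFieldFamily F)
    (d : ∀ (p : ℕ) (hp : p.Prime), (@realPrimePacket F _ _ p ⟨hp⟩ (𝔽 p hp)).DHDatum X)
    (T : Finset ℕ) (T_prime : ∀ p ∈ T, p.Prime) (S_sub : ∀ v ∈ X.S, residueChar F v ∈ T) : DHData F :=
  DHData.ofPrimesLine X (fun p hp => @realPrimePacket F _ _ p ⟨hp⟩ (𝔽 p hp)) d T T_prime S_sub

/-- Its model IS the tensor-packet model. [cite: DupuyHilado2025, Def. 3.6.1] -/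
theorem ofTensor_M (X : PilotData F) (𝔽 : LocalFieldFamily F)
    (d : ∀ (p : ℕ) (hp : p.Prime), (@realPrimePacket F _ _ p ⟨hp⟩ (𝔽 p hp)).DHDatum X)
    (T : Finset ℕ) (T_prime : ∀ p ∈ T, p.Prime) (S_sub : ∀ v ∈ X.S, residueChar F v ∈ T) :
    (ofTensor X 𝔽 d T T_prime S_sub).M = tensorPacketModel 𝔽 := rfl

/-- **The free inequality over real tensor packets**: `−deĝ̲_lgp(P_Θ) ≤ ln ν̄_𝕃(hull(U_Θ))` for EVERY real datum
— `LDHCor312.free_inequality`, now with Thm. 3.10.1, the (Ind1)/(Ind2)-invariance and the admissibility of the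
hull all THEOREMS of Haar measure on `⊗_{ℚ_p} K_{v̲_i}`. [cite: DupuyHilado2025, §4.10–4.12] -/
theorem free_inequality_ofTensor (X : PilotData F) (𝔽 : LocalFieldFamily F)
    (d : ∀ (p : ℕ) (hp : p.Prime), (@realPrimePacket F _ _ p ⟨hp⟩ (𝔽 p hp)).DHDatum X)
    (T : Finset ℕ) (T_prime : ∀ p ∈ T, p.Prime) (S_sub : ∀ v ∈ X.S, residueChar F v ∈ T) :
    -LgpDivisor.ndegLgp X.thetaPilot ≤ (ofTensor X 𝔽 d T T_prime S_sub).negLogThetaDH :=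
  (ofTensor X 𝔽 d T T_prime S_sub).free_inequality

/-- **(1.1) over real tensor packets ⟺ inflation** by at least `deĝ̲_lgp(P_Θ) − deĝ̲(P_q) > 0`
(`LDHCor312.cor312DH_iff_inflation` in the real model). HYPOTHESIS on both sides; nothing asserted.
[claim: Mochizuki2012, status: disputed] -/
theorem cor312DH_ofTensor_iff_inflation (X : PilotData F) (𝔽 : LocalFieldFamily F)
    (d : ∀ (p : ℕ) (hp : p.Prime), (@realPrimePacket F _ _ p ⟨hp⟩ (𝔽 p hp)).DHDatum X)
    (T : Finset ℕ) (T_prime : ∀ p ∈ T, p.Prime) (S_sub : ∀ v ∈ X.S, residueChar F v ∈ T) :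
    (ofTensor X 𝔽 d T T_prime S_sub).Cor312DH ↔
      LgpDivisor.ndegLgp X.thetaPilot - FinDivisor.ndeg F X.qPilot ≤
        (ofTensor X 𝔽 d T T_prime S_sub).negLogThetaDH -
          (tensorPacketModel 𝔽).lnνL X.lstar T ((tensorPacketModel 𝔽).region (ofTensor X 𝔽 d T T_prime S_sub).tΘ) :=
  (ofTensor X 𝔽 d T T_prime S_sub).cor312DH_iff_inflation

/-- **Dupuy–Hilado data over the tensor-packet model in MOCHIZUKI's shell normalisation, from the IDELES ALONE**
(the minimal (Ind3)-datum `O_𝕃(−P_Θ)` at every prime, the canonical line datum at composite indices): no region is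
an input. Ideles with the printed valuations exist iff each `K_{v̲}`, `v ∈ S`, contains an element of valuation
`ord_v(q_v)/(2l)` — e.g. `q̲_v` ([IUTchI] Ex. 3.2 (iv)). [cite: Mochizuki2012, IUTchIV Prop. 1.2 (ii) p. 10] -/
def ofIdelesM (X : PilotData F) (𝔽 : LocalFieldFamily F)
    (tΘ : ∀ (p : ℕ) (hp : p.Prime), Fin X.lstar → (v : placesOver F p) → (@LocalFields.k F _ _ p ⟨hp⟩ (𝔽 p hp) v)ˣ)
    (tΘ_ord : ∀ p hp (i : Fin X.lstar) (v : placesOver F p),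
      @LocalFields.ordv F _ _ p ⟨hp⟩ (𝔽 p hp) v (tΘ p hp i v) = X.thetaPilot i v.1)
    (tq : ∀ (p : ℕ) (hp : p.Prime), Fin X.lstar → (v : placesOver F p) → (@LocalFields.k F _ _ p ⟨hp⟩ (𝔽 p hp) v)ˣ)
    (tq_ord : ∀ p hp (i : Fin X.lstar) (v : placesOver F p),
      @LocalFields.ordv F _ _ p ⟨hp⟩ (𝔽 p hp) v (tq p hp i v) = X.qPilot v.1)
    (T : Finset ℕ) (T_prime : ∀ p ∈ T, p.Prime) (S_sub : ∀ v ∈ X.S, residueChar F v ∈ T) : DHData F :=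
  DHData.ofPrimesLine X (fun p hp => @realPrimePacketM F _ _ p ⟨hp⟩ (𝔽 p hp))
    (fun p hp => @PrimePacket.minimalDHDatumM F _ _ p ⟨hp⟩ (𝔽 p hp) X (tΘ p hp) (tΘ_ord p hp) (tq p hp)
      (tq_ord p hp))
    T T_prime S_sub

/-- Its model IS the tensor-packet model in Mochizuki's normalisation. [cite: Mochizuki2012, IUTchIV Prop. 1.2 (ii) p. 10] -/
theorem ofIdelesM_M (X : PilotData F) (𝔽 : LocalFieldFamily F)
    (tΘ : ∀ (p : ℕ) (hp : p.Prime), Fin X.lstar → (v : placesOver F p) → (@LocalFields.k F _ _ p ⟨hp⟩ (𝔽 p hp) v)ˣ)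
    (tΘ_ord : ∀ p hp (i : Fin X.lstar) (v : placesOver F p),
      @LocalFields.ordv F _ _ p ⟨hp⟩ (𝔽 p hp) v (tΘ p hp i v) = X.thetaPilot i v.1)
    (tq : ∀ (p : ℕ) (hp : p.Prime), Fin X.lstar → (v : placesOver F p) → (@LocalFields.k F _ _ p ⟨hp⟩ (𝔽 p hp) v)ˣ)
    (tq_ord : ∀ p hp (i : Fin X.lstar) (v : placesOver F p),
      @LocalFields.ordv F _ _ p ⟨hp⟩ (𝔽 p hp) v (tq p hp i v) = X.qPilot v.1)
    (T : Finset ℕ) (T_prime : ∀ p ∈ T, p.Prime) (S_sub : ∀ v ∈ X.S, residueChar F v ∈ T) :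
    (ofIdelesM X 𝔽 tΘ tΘ_ord tq tq_ord T T_prime S_sub).M = tensorPacketModelM 𝔽 := rfl

/-- The free inequality for the idele-built datum (everything real, nothing assumed beyond the ideles).
[cite: DupuyHilado2025, §4.10–4.12] -/
theorem free_inequality_ofIdelesM (X : PilotData F) (𝔽 : LocalFieldFamily F)
    (tΘ : ∀ (p : ℕ) (hp : p.Prime), Fin X.lstar → (v : placesOver F p) → (@LocalFields.k F _ _ p ⟨hp⟩ (𝔽 p hp) v)ˣ)
    (tΘ_ord : ∀ p hp (i : Fin X.lstar) (v : placesOver F p),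
      @LocalFields.ordv F _ _ p ⟨hp⟩ (𝔽 p hp) v (tΘ p hp i v) = X.thetaPilot i v.1)
    (tq : ∀ (p : ℕ) (hp : p.Prime), Fin X.lstar → (v : placesOver F p) → (@LocalFields.k F _ _ p ⟨hp⟩ (𝔽 p hp) v)ˣ)
    (tq_ord : ∀ p hp (i : Fin X.lstar) (v : placesOver F p),
      @LocalFields.ordv F _ _ p ⟨hp⟩ (𝔽 p hp) v (tq p hp i v) = X.qPilot v.1)
    (T : Finset ℕ) (T_prime : ∀ p ∈ T, p.Prime) (S_sub : ∀ v ∈ X.S, residueChar F v ∈ T) :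
    -LgpDivisor.ndegLgp X.thetaPilot ≤ (ofIdelesM X 𝔽 tΘ tΘ_ord tq tq_ord T T_prime S_sub).negLogThetaDH :=
  (ofIdelesM X 𝔽 tΘ tΘ_ord tq tq_ord T T_prime S_sub).free_inequality

end DHData

end Summit.ABC.IUTFork

end
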